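import Literature.Analysis.FluidPDE.PassiveVectorTensorPropagator
import Literature.Analysis.FluidPDE.LerayProjectorTorusProofs
import Literature.Analysis.FunctionSpaces.TorusFluidGlueProofs
import Literature.Analysis.FunctionSpaces.TorusTimeAverage
import HarnessLib

/-!
# The orthogonal projection onto the weakly divergence-free `L²` classes acts MODE BY MODE

Analysis/FluidPDE file (pure proof layer; no definitions, no named facts).  For the closed subspace
`Torus.divFreeL2 d ⊆ L²(𝕋^d; ℝ^d)` of weakly divergence-free classes (`PassiveVectorTensorPropagator`; it CONTAINS the constants,
unlike the mean-zero energy space `H` of `LerayProjectorTorusProofs`) and its orthogonal projection `P = (divFreeL2 d).starProjection`: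
* `sum_mul_mFourierCoeff_starProjection_eq_zero` — the coefficients of `P y` are transversal, `k · 𝓕(P y)(k) = 0`;
* `toLp_realTrigPoly_singleton_mem_divFreeL2` — a transversal single real mode `Re (e_k z)` (`k · z = 0`; ANY `z` at `k = 0`) is in `divFreeL2`;
* `inner_mFourierCoeff_eq_zero_of_mem_divFreeL2_orthogonal` — for `w ⊥ divFreeL2`, `⟪ŵ(k), z⟫_ℂ = 0` for every transversal `z`
  (so `ŵ(0) = 0`, `mFourierCoeff_zero_eq_zero_of_mem_divFreeL2_orthogonal`, and `ŵ(k) ∥ k`);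
* `inner_mFourierCoeff_starProjection_sub_eq_zero` — `⟪𝓕(P y)(k), 𝓕(y − P y)(k)⟫_ℂ = 0` for every `k`;
* `norm_sq_mFourierCoeff_eq_add` — **modewise Pythagoras** `‖ŷ(k)‖² = ‖𝓕(P y)(k)‖² + ‖𝓕(y − P y)(k)‖²`, hence
  `norm_mFourierCoeff_starProjection_le` — `‖𝓕(P y)(k)‖ ≤ ‖ŷ(k)‖` (the projection is a modewise contraction).
This is Robinson–Rodrigo–Sadowski's frequency-wise Helmholtz decomposition `û_k = (û_k − α_k k) + α_k k` (proof of Thm. 2.6) for the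
mean-keeping space; the proofs are those of `LerayProjectorTorusProofs` with `H` replaced by `divFreeL2` (the zero mode is now kept by `P`).

Consumer: cell `ad-ideate`, K1L_D `stmt-AnomalousDissipation-27980`, W3-E `stub_effectiveFrameEnergyL` (i): the propagator vanishes on
`(divFreeL2)ᗮ`, so a modewise dissipation floor on div-free data passes to all of `L²` through this decomposition (memo
`Lines/onelevel-W3E-k3l-lyapunov.md` §6, P4a).

## Mathlib / tree search
Tree: `Torus.divFreeL2`, `mem_divFreeL2_iff` (PassiveVectorTensorPropagator); `inner_toLp_realTrigPoly_singleton` (LerayProjectorTorusProofs);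
`IsWeaklyDivFree.sum_mul_mFourierCoeff_eq_zero`, `memLp_realTrigPoly`, `isSmooth_realTrigPoly` (TorusTrigPoly); `isDivFree_realTrigPoly_singleton`
(TorusFourierModes); `IsDivFree.isWeaklyDivFree_holds` (TorusFluidGlueProofs); `IsWeaklyDivFree.congr_ae` (TorusTimeAverage);
`mFourierCoeff_complexify_coe_sub` (StatisticalSolutionProofs).  Mathlib: `Submodule.starProjection_apply_mem`,
`Submodule.sub_starProjection_mem_orthogonal`, `Submodule.inner_left_of_mem_orthogonal`, `norm_add_sq_eq_norm_sq_add_norm_sq_of_inner_eq_zero`.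

## References
* J. C. Robinson, J. L. Rodrigo, W. Sadowski, *The Three-Dimensional Navier–Stokes Equations*, CUP 2016, §2.1: Lemma 2.3, Thm. 2.6 (proof),
  Def. 2.8. [`RobinsonRodrigoSadowskiCUP2016`]
-/

noncomputable section

open MeasureTheory Filter UnitAddTorus
open scoped InnerProductSpace RealInnerProductSpace ENNReal

namespace Literature.Analysis.FluidPDE

namespace Torus

variable {d : Type*} [Fintype d] [DecidableEq d]

/-- **Coefficients of the projection are transversal**: `k · 𝓕(P y)(k) = 0` (`P y` is weakly divergence free).
[cite: RobinsonRodrigoSadowskiCUP2016, Lemma 2.3] -/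
theorem sum_mul_mFourierCoeff_starProjection_eq_zero (y : Lp (EuclideanSpace ℝ d) 2 (volume : Measure (UnitAddTorus d))) (k : d → ℤ) :
    ∑ j, (k j : ℂ) * mFourierCoeff (FunctionSpaces.EuclideanSpace.complexify ∘
      (((divFreeL2 d).starProjection y : Lp (EuclideanSpace ℝ d) 2 (volume : Measure (UnitAddTorus d))) :
        UnitAddTorus d → EuclideanSpace ℝ d)) k j = 0 :=
  FunctionSpaces.Torus.IsWeaklyDivFree.sum_mul_mFourierCoeff_eq_zero (Lp.memLp _)
    ((mem_divFreeL2_iff _).1 (Submodule.starProjection_apply_mem _ y)) k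

/-- **A transversal single real mode lies in `divFreeL2`**: for `k · z = 0` (no condition when `k = 0`: the constants are divergence free),
the class of `Re (e_k z)` is weakly divergence free. [cite: RobinsonRodrigoSadowskiCUP2016, Lemma 2.3] -/
theorem toLp_realTrigPoly_singleton_mem_divFreeL2 {k : d → ℤ} {c : (d → ℤ) → EuclideanSpace ℂ d} (hc : ∑ j, (k j : ℂ) * c k j = 0) :
    (FunctionSpaces.Torus.memLp_realTrigPoly {k} c 2).toLp (FunctionSpaces.Torus.realTrigPoly {k} c) ∈ divFreeL2 d := by
  rw [mem_divFreeL2_iff]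
  have hw : FunctionSpaces.Torus.IsWeaklyDivFree (FunctionSpaces.Torus.realTrigPoly {k} c) :=
    FunctionSpaces.Torus.IsDivFree.isWeaklyDivFree_holds (FunctionSpaces.Torus.isSmooth_realTrigPoly _ _)
      (FunctionSpaces.Torus.isDivFree_realTrigPoly_singleton hc)
  exact hw.congr_ae (MemLp.coeFn_toLp _).symm

/-- **Coefficients of a class orthogonal to `divFreeL2` are longitudinal**: if `w ⊥ divFreeL2` and `z ∈ ℂ^d` is transversal at `k`
(`k · z = 0`), then `⟪ŵ(k), z⟫_ℂ = 0`. [cite: RobinsonRodrigoSadowskiCUP2016, Thm. 2.6 (proof)] -/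
theorem inner_mFourierCoeff_eq_zero_of_mem_divFreeL2_orthogonal
    {w : Lp (EuclideanSpace ℝ d) 2 (volume : Measure (UnitAddTorus d))} (hw : w ∈ (divFreeL2 d)ᗮ) {k : d → ℤ}
    {z : EuclideanSpace ℂ d} (hz : ∑ j, (k j : ℂ) * z j = 0) :
    inner ℂ (mFourierCoeff (FunctionSpaces.EuclideanSpace.complexify ∘ (w : UnitAddTorus d → EuclideanSpace ℝ d)) k) z = 0 := by
  have hre : ∀ z : EuclideanSpace ℂ d, ∑ j, (k j : ℂ) * z j = 0 →
      (inner ℂ (mFourierCoeff (FunctionSpaces.EuclideanSpace.complexify ∘ (w : UnitAddTorus d → EuclideanSpace ℝ d)) k) z).re = 0 := by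
    intro z hz
    rw [← inner_toLp_realTrigPoly_singleton w k (fun _ => z)]
    exact Submodule.inner_left_of_mem_orthogonal (toLp_realTrigPoly_singleton_mem_divFreeL2 hz) hw
  have hIz : ∑ j, (k j : ℂ) * (Complex.I • z) j = 0 := by
    have h : ∑ j, (k j : ℂ) * (Complex.I • z) j = Complex.I * ∑ j, (k j : ℂ) * z j := by
      rw [Finset.mul_sum]
      refine Finset.sum_congr rfl fun j _ => ?_
      rw [PiLp.smul_apply, smul_eq_mul]
      ring
    rw [h, hz, mul_zero]
  have h1 := hre z hz
  have h2 := hre _ hIz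
  rw [inner_smul_right, Complex.mul_re, Complex.I_re, Complex.I_im, zero_mul, one_mul, zero_sub, neg_eq_zero] at h2
  apply Complex.ext
  · simpa using h1
  · simpa using h2

/-- The zero mode of a class orthogonal to `divFreeL2` vanishes (the constants are in `divFreeL2`).
[cite: RobinsonRodrigoSadowskiCUP2016, Thm. 2.6 (proof)] -/
theorem mFourierCoeff_zero_eq_zero_of_mem_divFreeL2_orthogonal
    {w : Lp (EuclideanSpace ℝ d) 2 (volume : Measure (UnitAddTorus d))} (hw : w ∈ (divFreeL2 d)ᗮ) :
    mFourierCoeff (FunctionSpaces.EuclideanSpace.complexify ∘ (w : UnitAddTorus d → EuclideanSpace ℝ d)) 0 = 0 := by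
  rw [← inner_self_eq_zero (𝕜 := ℂ)]
  exact inner_mFourierCoeff_eq_zero_of_mem_divFreeL2_orthogonal hw (k := 0) (by simp)

/-- **The two pieces are orthogonal mode by mode**: `⟪𝓕(P y)(k), 𝓕(y − P y)(k)⟫_ℂ = 0`.
[cite: RobinsonRodrigoSadowskiCUP2016, Thm. 2.6 (proof)] -/
theorem inner_mFourierCoeff_starProjection_sub_eq_zero (y : Lp (EuclideanSpace ℝ d) 2 (volume : Measure (UnitAddTorus d))) (k : d → ℤ) :
    inner ℂ (mFourierCoeff (FunctionSpaces.EuclideanSpace.complexify ∘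
        ((y - (divFreeL2 d).starProjection y : Lp (EuclideanSpace ℝ d) 2 (volume : Measure (UnitAddTorus d))) :
          UnitAddTorus d → EuclideanSpace ℝ d)) k)
      (mFourierCoeff (FunctionSpaces.EuclideanSpace.complexify ∘
        (((divFreeL2 d).starProjection y : Lp (EuclideanSpace ℝ d) 2 (volume : Measure (UnitAddTorus d))) :
          UnitAddTorus d → EuclideanSpace ℝ d)) k) = 0 :=
  inner_mFourierCoeff_eq_zero_of_mem_divFreeL2_orthogonal (Submodule.sub_starProjection_mem_orthogonal y)
    (sum_mul_mFourierCoeff_starProjection_eq_zero y k)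

/-- **Modewise Pythagoras for the divergence-free projection**: `‖ŷ(k)‖² = ‖𝓕(P y)(k)‖² + ‖𝓕(y − P y)(k)‖²` for every `k`.
[cite: RobinsonRodrigoSadowskiCUP2016, Thm. 2.6 (proof)] -/
theorem norm_sq_mFourierCoeff_eq_add (y : Lp (EuclideanSpace ℝ d) 2 (volume : Measure (UnitAddTorus d))) (k : d → ℤ) :
    ‖mFourierCoeff (FunctionSpaces.EuclideanSpace.complexify ∘ (y : UnitAddTorus d → EuclideanSpace ℝ d)) k‖ ^ 2 =
      ‖mFourierCoeff (FunctionSpaces.EuclideanSpace.complexify ∘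
          (((divFreeL2 d).starProjection y : Lp (EuclideanSpace ℝ d) 2 (volume : Measure (UnitAddTorus d))) :
            UnitAddTorus d → EuclideanSpace ℝ d)) k‖ ^ 2 +
        ‖mFourierCoeff (FunctionSpaces.EuclideanSpace.complexify ∘
          ((y - (divFreeL2 d).starProjection y : Lp (EuclideanSpace ℝ d) 2 (volume : Measure (UnitAddTorus d))) :
            UnitAddTorus d → EuclideanSpace ℝ d)) k‖ ^ 2 := by
  set P := (divFreeL2 d).starProjection y with hP
  have hsplit : mFourierCoeff (FunctionSpaces.EuclideanSpace.complexify ∘ (y : UnitAddTorus d → EuclideanSpace ℝ d)) k =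
      mFourierCoeff (FunctionSpaces.EuclideanSpace.complexify ∘
          ((P : Lp (EuclideanSpace ℝ d) 2 (volume : Measure (UnitAddTorus d))) : UnitAddTorus d → EuclideanSpace ℝ d)) k +
        mFourierCoeff (FunctionSpaces.EuclideanSpace.complexify ∘
          ((y - P : Lp (EuclideanSpace ℝ d) 2 (volume : Measure (UnitAddTorus d))) : UnitAddTorus d → EuclideanSpace ℝ d)) k := by
    rw [mFourierCoeff_complexify_coe_sub]
    abel
  rw [hsplit, sq, sq, sq]
  refine norm_add_sq_eq_norm_sq_add_norm_sq_of_inner_eq_zero (𝕜 := ℂ) _ _ ?_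
  have h := inner_mFourierCoeff_starProjection_sub_eq_zero y k
  rw [← inner_conj_symm, h, map_zero]

/-- **The divergence-free projection is a modewise contraction**: `‖𝓕(P y)(k)‖ ≤ ‖ŷ(k)‖` for every `k`.
[cite: RobinsonRodrigoSadowskiCUP2016, Thm. 2.6 (proof)] -/
theorem norm_mFourierCoeff_starProjection_le (y : Lp (EuclideanSpace ℝ d) 2 (volume : Measure (UnitAddTorus d))) (k : d → ℤ) :
    ‖mFourierCoeff (FunctionSpaces.EuclideanSpace.complexify ∘
        (((divFreeL2 d).starProjection y : Lp (EuclideanSpace ℝ d) 2 (volume : Measure (UnitAddTorus d))) :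
          UnitAddTorus d → EuclideanSpace ℝ d)) k‖ ≤
      ‖mFourierCoeff (FunctionSpaces.EuclideanSpace.complexify ∘ (y : UnitAddTorus d → EuclideanSpace ℝ d)) k‖ := by
  have h := norm_sq_mFourierCoeff_eq_add y k
  have h2 : ‖mFourierCoeff (FunctionSpaces.EuclideanSpace.complexify ∘
        (((divFreeL2 d).starProjection y : Lp (EuclideanSpace ℝ d) 2 (volume : Measure (UnitAddTorus d))) :
          UnitAddTorus d → EuclideanSpace ℝ d)) k‖ ^ 2 ≤
      ‖mFourierCoeff (FunctionSpaces.EuclideanSpace.complexify ∘ (y : UnitAddTorus d → EuclideanSpace ℝ d)) k‖ ^ 2 := by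
    rw [h]
    nlinarith [sq_nonneg ‖mFourierCoeff (FunctionSpaces.EuclideanSpace.complexify ∘
          ((y - (divFreeL2 d).starProjection y : Lp (EuclideanSpace ℝ d) 2 (volume : Measure (UnitAddTorus d))) :
            UnitAddTorus d → EuclideanSpace ℝ d)) k‖]
  exact (pow_le_pow_iff_left₀ (norm_nonneg _) (norm_nonneg _) two_ne_zero).1 h2
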